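import Literature.Computability.QuantumComplexity.Lemma24CodeBricks
import HarnessLib

/-!
# Aaronson–Ambainis Lemma 24 over the sign basis, XII-b: the instance code is polynomial time

Part of the discharge of `AaronsonAmbainis2018_lemma24_sign_hard` (plan in `Lemma24Catalysis.lean`).
From the bricks of `Lemma24CodeBricks.lean` this file assembles the string function `outF` that, on
the record `⟨x, ⟨bin n, ⟨1^m, encList (codes of cs)⟩⟩⟩` (`n = |x|`, `cs` well-formed Clifford+`T` gate
shadows), returns `⟨1^{24(4(n+m)+7)}, encList (codes of instNL n m x cs)⟩` — the code of the QSIM instance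
of the reduction (`Lemma24Codes.instNL`; that it *is* that code is `Lemma24Shadow.encode_lemma24Instance`)
— and proves `outF ∈ FP` (`outF_mem_FP`) and its value (`outF_record`).

The assembly follows the shape of `instNL`: `24` blocks, each the concatenation of `21` parts — the
gadget template, four preparation folds, four transcription folds, the OR template, the copy template,
and the same backwards (reversed templates, folds over the reversed lists) —, every numeral being an
affine function of `w = n + m` with coefficients depending on the block and copy indices
(`Lemma24CodeBricks.numF`). Arora–Barak 2009, §1.3 (closure of polynomial time under composition and
bounded loops), §6.1 (descriptions of circuits).

## References

* S. Aaronson, A. Ambainis, *Forrelation*, SIAM J. Comput. 47 (2018), §6, Lemma 24 (p. 26).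
* S. Arora, B. Barak, *Computational Complexity: A Modern Approach*, CUP 2009, §1.3, §6.1.
-/

noncomputable section

namespace Literature.Computability.QuantumComplexity

open _root_.Computability Polynomial Complexity Complexity.Brick Complexity.Plumb Complexity.Com

namespace Lemma24

/-! ### The parts of a block, as lists of shadows -/

section lists

variable (n m : ℕ) (x : List Bool) (cs : List NGate) (j : ℕ)

/-- The catalyst wire of block `j`. [folklore] -/
def catJ : ℕ := Kw (n + m) + j * (Kw (n + m) + 2 + 1)
/-- The real/imaginary wire of block `j`. [folklore] -/
def rhoJ : ℕ := Kw (n + m) + 2 + j * (Kw (n + m) + 2 + 1)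
/-- The helper wire of block `j`. [folklore] -/
def hlpJ : ℕ := Kw (n + m) + 1 + j * (Kw (n + m) + 2 + 1)
/-- The base offset of copy `i` of block `j`. [folklore] -/
def baseJ (i : ℕ) : ℕ := i * (n + m) + j * (Kw (n + m) + 2 + 1)

/-- The preparation part of copy `i` (forward). [cite: AaronsonAmbainis2018, §6 Lemma 24 (p. 26)] -/
def prepPart (i : ℕ) : List NGate :=
  (List.range n).flatMap fun l =>
    if x.getD l false = true then (xWordN (baseJ n m j i + l)).flatMap (realGatesN' (catJ n m j) (rhoJ n m j)) else []

/-- The preparation part of copy `i` (backward). [cite: AaronsonAmbainis2018, §6 Lemma 24 (p. 26)] -/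
def prepPartR (i : ℕ) : List NGate :=
  (List.range n).reverse.flatMap fun l =>
    if x.getD l false = true then ((xWordN (baseJ n m j i + l)).flatMap (realGatesN' (catJ n m j) (rhoJ n m j))).reverse else []

/-- The transcription part of copy `i` (forward). [cite: AaronsonAmbainis2018, §6 Lemma 24 (p. 26)] -/
def transPart (i : ℕ) : List NGate :=
  cs.flatMap fun g => realGatesN' (catJ n m j) (rhoJ n m j) (g.shift (baseJ n m j i))

/-- The transcription part of copy `i` (backward). [cite: AaronsonAmbainis2018, §6 Lemma 24 (p. 26)] -/
def transPartR (i : ℕ) : List NGate :=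
  cs.reverse.flatMap fun g => (realGatesN' (catJ n m j) (rhoJ n m j) (g.shift (baseJ n m j i))).reverse

/-- The OR part. [cite: AaronsonAmbainis2018, §6 Lemma 24 (p. 26)] -/
def orPart : List NGate :=
  if 0 < n + m then
    (orN.orN' (j * (Kw (n + m) + 2 + 1)) (n + m + j * (Kw (n + m) + 2 + 1)) (2 * (n + m) + j * (Kw (n + m) + 2 + 1))
      (3 * (n + m) + j * (Kw (n + m) + 2 + 1)) (4 * (n + m) + j * (Kw (n + m) + 2 + 1))
      (4 * (n + m) + 1 + j * (Kw (n + m) + 2 + 1)) (4 * (n + m) + 2 + j * (Kw (n + m) + 2 + 1))).flatMap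
    (realGatesN' (catJ n m j) (rhoJ n m j)) else []

/-- **The shifted block, part by part.** [cite: AaronsonAmbainis2018, §6 Lemma 24 (p. 26)] -/
theorem blockNL_shift :
    (blockNL n m x cs).map (NGate.shift (j * (Kw (n + m) + 2 + 1))) =
      gadgetN' (catJ n m j) (rhoJ n m j) (hlpJ n m j) ++
        ((List.range 4).flatMap (prepPart n m x j) ++ ((List.range 4).flatMap (transPart n m cs j) ++ orPart n m j)) ++
      (copyN (4 * (n + m) + 2 + j * (Kw (n + m) + 2 + 1)) (4 * (n + m) + 3 + j * (Kw (n + m) + 2 + 1)) ++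
        ((orPart n m j).reverse ++ ((List.range 4).reverse.flatMap (transPartR n m cs j) ++
          (List.range 4).reverse.flatMap (prepPartR n m x j)) ++ (gadgetN' (catJ n m j) (rhoJ n m j) (hlpJ n m j)).reverse)) := by
  -- shifting is renaming
  have hsh : NGate.shift (j * (Kw (n + m) + 2 + 1)) = NGate.ren (· + j * (Kw (n + m) + 2 + 1)) := rfl
  have hmain : ((mainNL n m x cs).map (NGate.shift (j * (Kw (n + m) + 2 + 1)))).flatMap (realGatesN' (catJ n m j) (rhoJ n m j)) =
      (List.range 4).flatMap (prepPart n m x j) ++ ((List.range 4).flatMap (transPart n m cs j) ++ orPart n m j) := by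
    rw [mainNL, List.map_append, List.map_append, List.flatMap_append, List.flatMap_append]
    congr 1
    · -- preparation
      rw [prepNL, List.map_flatMap, List.flatMap_assoc]
      refine flatMap_congr_mem fun i _ => ?_
      rw [List.map_flatMap, List.flatMap_assoc, prepPart]
      refine flatMap_congr_mem fun l _ => ?_
      split_ifs
      · rw [hsh, ren_xWordN, show i * (n + m) + l + j * (Kw (n + m) + 2 + 1) = baseJ n m j i + l by unfold baseJ; ring]
      · rfl
    congr 1
    · -- copies
      rw [copiesN, List.map_flatMap, List.flatMap_assoc]
      refine flatMap_congr_mem fun i _ => ?_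
      rw [List.map_map, transPart, flatMap_map_comp]
      refine flatMap_congr_mem fun g _ => ?_
      simp only [Function.comp_apply, NGate.shift_shift]; rfl
    · -- OR
      rw [orN, orPart]
      split_ifs
      · rw [hsh, ren_orN', Nat.zero_add]
      · rfl
  have hreal : ∀ L : List NGate, (L.flatMap (realGatesN (Kw (n + m)))).map (NGate.shift (j * (Kw (n + m) + 2 + 1))) =
      (L.map (NGate.shift (j * (Kw (n + m) + 2 + 1)))).flatMap (realGatesN' (catJ n m j) (rhoJ n m j)) := by
    intro L
    rw [List.map_flatMap, flatMap_map_comp]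
    refine flatMap_congr_mem fun g _ => ?_
    rw [hsh, realGatesN, ren_realGatesN']; rfl
  have hgad : (gadgetN (Kw (n + m))).map (NGate.shift (j * (Kw (n + m) + 2 + 1))) =
      gadgetN' (catJ n m j) (rhoJ n m j) (hlpJ n m j) := by
    rw [hsh, gadgetN, ren_gadgetN']; rfl
  have hrev : ((List.range 4).flatMap (prepPart n m x j) ++ ((List.range 4).flatMap (transPart n m cs j) ++ orPart n m j)).reverse =
      (orPart n m j).reverse ++ ((List.range 4).reverse.flatMap (transPartR n m cs j) ++
        (List.range 4).reverse.flatMap (prepPartR n m x j)) := by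
    rw [List.reverse_append, List.reverse_append, List.append_assoc]
    congr 2
    · rw [List.reverse_flatMap]
      refine flatMap_congr_mem fun i _ => ?_
      rw [Function.comp_apply, transPart, transPartR, List.reverse_flatMap]; rfl
    · rw [List.reverse_flatMap]
      refine flatMap_congr_mem fun i _ => ?_
      rw [Function.comp_apply, prepPart, prepPartR, List.reverse_flatMap]
      refine flatMap_congr_mem fun l _ => ?_
      simp only [Function.comp_apply]
      split_ifs <;> rfl
  rw [blockNL]
  simp only [List.map_append, List.map_reverse, hreal, hmain, hgad]
  rw [hsh, ren_copyN, List.reverse_append, hrev]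

end lists

/-! ### The parts of a block, as string functions -/

/-- The coefficients `(a, b)` (numeral `a·w + b`) of the parameters of block `j`: `0 ↦ D`, `1 ↦ w + D`,
`2 ↦ 2w + D`, `3 ↦ 3w + D`, `4 ↦ 4w + D`, `5 ↦ 4w+1+D`, `6 ↦ 4w+2+D` (flag), `7 ↦ 4w+4+D` (cat), `8 ↦ 4w+6+D` (`ρ`),
`9 ↦ 4w+5+D` (hlp), `10 ↦ 4w+3+D` (fresh), where `D = j (4w+7)`. [folklore] -/
def coefJ (j i : ℕ) : ℕ × ℕ :=
  if i = 0 then (4 * j, 7 * j) else if i = 1 then (4 * j + 1, 7 * j) else if i = 2 then (4 * j + 2, 7 * j)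
  else if i = 3 then (4 * j + 3, 7 * j) else if i = 4 then (4 * j + 4, 7 * j) else if i = 5 then (4 * j + 4, 7 * j + 1)
  else if i = 6 then (4 * j + 4, 7 * j + 2) else if i = 7 then (4 * j + 4, 7 * j + 4) else if i = 8 then (4 * j + 4, 7 * j + 6)
  else if i = 9 then (4 * j + 4, 7 * j + 5) else (4 * j + 4, 7 * j + 3)

/-- The parameter numerals of block `j`. [folklore] -/
def ΘJ (j i : ℕ) : List Bool → List Bool := numF (coefJ j i).1 (coefJ j i).2

/-- The values of the parameters of block `j` at `w`. [folklore] -/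
def θJ (ww j i : ℕ) : ℕ := (coefJ j i).1 * ww + (coefJ j i).2

/-- The parameter numerals are in `FP`. [folklore] -/
theorem ΘJ_mem_FP (j i : ℕ) : ΘJ j i ∈ FP := numF_mem_FP _ _

/-- The parameter numerals evaluate to the parameters. [folklore] -/
theorem ΘJ_apply (j i : ℕ) (r : List Bool) : ΘJ j i r = encodeNat (θJ (uwF r).length j i) := numF_apply _ _ r

/-- The coefficients are bounded. [folklore] -/
theorem coefJ_le (j i : ℕ) : (coefJ j i).1 ≤ 4 * j + 4 ∧ (coefJ j i).2 ≤ 7 * j + 6 := by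
  unfold coefJ; split_ifs <;> simp

/-- The parameter numerals are short. [folklore] -/
theorem length_ΘJ_le {j : ℕ} (hj : j < 24) (i : ℕ) (r : List Bool) : (ΘJ j i r).length ≤ 99 * r.length + 167 := by
  refine (length_numF_le _ _ r).trans ?_
  have h := coefJ_le j i
  have : (coefJ j i).1 * r.length ≤ (4 * j + 4) * r.length := Nat.mul_le_mul_right _ h.1
  nlinarith

section params

variable (n m j : ℕ)

/-- Parameter `7` is the catalyst. [folklore] -/
theorem θJ_7 : θJ (n + m) j 7 = catJ n m j := by simp [θJ, coefJ, catJ, Kw]; ring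
/-- Parameter `8` is the real/imaginary wire. [folklore] -/
theorem θJ_8 : θJ (n + m) j 8 = rhoJ n m j := by simp [θJ, coefJ, rhoJ, Kw]; ring
/-- Parameter `9` is the helper. [folklore] -/
theorem θJ_9 : θJ (n + m) j 9 = hlpJ n m j := by simp [θJ, coefJ, hlpJ, Kw]; ring
/-- Parameter `0` is the block offset. [folklore] -/
theorem θJ_0 : θJ (n + m) j 0 = j * (Kw (n + m) + 2 + 1) := by simp [θJ, coefJ, Kw]; ring
/-- Parameter `1`. [folklore] -/
theorem θJ_1 : θJ (n + m) j 1 = (n + m) + j * (Kw (n + m) + 2 + 1) := by simp [θJ, coefJ, Kw]; ring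
/-- Parameter `2`. [folklore] -/
theorem θJ_2 : θJ (n + m) j 2 = 2 * (n + m) + j * (Kw (n + m) + 2 + 1) := by simp [θJ, coefJ, Kw]; ring
/-- Parameter `3`. [folklore] -/
theorem θJ_3 : θJ (n + m) j 3 = 3 * (n + m) + j * (Kw (n + m) + 2 + 1) := by simp [θJ, coefJ, Kw]; ring
/-- Parameter `4`. [folklore] -/
theorem θJ_4 : θJ (n + m) j 4 = 4 * (n + m) + j * (Kw (n + m) + 2 + 1) := by simp [θJ, coefJ, Kw]; ring
/-- Parameter `5`. [folklore] -/
theorem θJ_5 : θJ (n + m) j 5 = 4 * (n + m) + 1 + j * (Kw (n + m) + 2 + 1) := by simp [θJ, coefJ, Kw]; ring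
/-- Parameter `6` is the flag. [folklore] -/
theorem θJ_6 : θJ (n + m) j 6 = 4 * (n + m) + 2 + j * (Kw (n + m) + 2 + 1) := by simp [θJ, coefJ, Kw]; ring
/-- Parameter `10` is the fresh wire. [folklore] -/
theorem θJ_10 : θJ (n + m) j 10 = 4 * (n + m) + 3 + j * (Kw (n + m) + 2 + 1) := by simp [θJ, coefJ, Kw]; ring

/-- The base numeral's value. [folklore] -/
theorem baseJ_eq (i : ℕ) : (4 * j + i) * (n + m) + 7 * j = baseJ n m j i := by unfold baseJ Kw; ring

end params

/-- The base numeral of copy `i` in block `j`: `(i + 4j) w + 7j`. [folklore] -/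
def βJ (j i : ℕ) : List Bool → List Bool := numF (4 * j + i) (7 * j)

/-- The parameter record of the transducer for copy `i` of block `j`. [folklore] -/
def paramsF (j i : ℕ) : List Bool → List Bool := fanoutFn (βJ j i) (fanoutFn (ΘJ j 7) (ΘJ j 8))

/-- `paramsF j i ∈ FP`. [folklore] -/
theorem paramsF_mem_FP (j i : ℕ) : paramsF j i ∈ FP :=
  fanoutFn_mem_FP (numF_mem_FP _ _) (fanoutFn_mem_FP (ΘJ_mem_FP j 7) (ΘJ_mem_FP j 8))

/-- The OR template (forward): the OR program on parameters `0 … 6` transcribed with catalyst `7`, `ρ` `8`.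
[cite: AaronsonAmbainis2018, §6 Lemma 24 (p. 26)] -/
def orTm : List NGate := (orN.orN' 0 1 2 3 4 5 6).flatMap (realGatesN' 7 8)

/-- The gadget template: `cat = 7`, `ρ = 8`, `hlp = 9`. [cite: AaronsonAmbainis2018, §6 Lemma 24 (p. 26)] -/
def gadTm : List NGate := gadgetN' 7 8 9

/-- The copy template: flag `6`, fresh wire `10`. [cite: BennettBernsteinBrassardVazirani1997, Thm. 4.14 (proof)] -/
def copyTm : List NGate := copyN 6 10

/-- The size polynomial of a preparation piece. [folklore] -/
def Qprep : Polynomial ℕ := C 12120 * X + C 20720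

/-- **The parts of block `j`**, in order, as string functions of the record. [cite: AaronsonAmbainis2018, §6 Lemma 24 (p. 26)] -/
def partsF (j : ℕ) : List (List Bool → List Bool) :=
  [templF gadTm (ΘJ j)] ++
  ((List.range 4).map fun i => prepF Qprep false (βJ j i) (ΘJ j 8)) ++
  ((List.range 4).map fun i => transF false ∘ fanoutFn (paramsF j i) (sndPow 2)) ++
  [iteFn (isNilFn ∘ uwF) (fun _ => []) (templF orTm (ΘJ j)), templF copyTm (ΘJ j),
    iteFn (isNilFn ∘ uwF) (fun _ => []) (templF orTm.reverse (ΘJ j))] ++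
  ((List.range 4).reverse.map fun i => transF true ∘ fanoutFn (paramsF j i) (ForrMem.revItemsF ∘ sndPow 2)) ++
  ((List.range 4).reverse.map fun i => prepF Qprep true (βJ j i) (ΘJ j 8)) ++
  [templF gadTm.reverse (ΘJ j)]

/-- Concatenation of the values of a list of string functions. [folklore] -/
def concatF (fs : List (List Bool → List Bool)) : List Bool → List Bool := fun r => fs.flatMap (· r)

/-- `concatF fs ∈ FP` for `FP` entries. [cite: AroraBarak2009, §1.3] -/
theorem concatF_mem_FP : ∀ {fs : List (List Bool → List Bool)}, (∀ f ∈ fs, f ∈ FP) → concatF fs ∈ FP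
  | [], _ => by
    have : concatF [] = fun _ => [] := by funext r; simp [concatF]
    rw [this]; exact const_mem_FP _
  | f :: fs, h => by
    have : concatF (f :: fs) = fun r => f r ++ concatF fs r := by funext r; simp [concatF]
    rw [this]
    exact append_mem_FP (h f (by simp)) (concatF_mem_FP fun g hg => h g (by simp [hg]))

/-- **The code of block `j`.** [cite: AaronsonAmbainis2018, §6 Lemma 24 (p. 26)] -/
def blockF (j : ℕ) : List Bool → List Bool := concatF (partsF j)

/-- Every part is in `FP`. [folklore] -/
theorem partsF_mem_FP (j : ℕ) : ∀ f ∈ partsF j, f ∈ FP := by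
  intro f hf
  simp only [partsF, List.mem_append, List.mem_cons, List.mem_map, List.mem_nil_iff, or_false, List.mem_reverse] at hf
  rcases hf with (((((rfl | ⟨i, -, rfl⟩) | ⟨i, -, rfl⟩) | (rfl | rfl | rfl)) | ⟨i, -, rfl⟩) | ⟨i, -, rfl⟩) | rfl
  · exact templF_mem_FP _ (ΘJ_mem_FP j)
  · exact prepF_mem_FP _ _ (numF_mem_FP _ _) (ΘJ_mem_FP j 8)
  · exact comp_mem_FP (transF_mem_FP false) (fanoutFn_mem_FP (paramsF_mem_FP j i) (sndPow_mem_FP 2))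
  · exact iteFn_mem_FP (comp_mem_FP isNilFn_mem_FP uwF_mem_FP) (const_mem_FP _) (templF_mem_FP _ (ΘJ_mem_FP j))
  · exact templF_mem_FP _ (ΘJ_mem_FP j)
  · exact iteFn_mem_FP (comp_mem_FP isNilFn_mem_FP uwF_mem_FP) (const_mem_FP _) (templF_mem_FP _ (ΘJ_mem_FP j))
  · exact comp_mem_FP (transF_mem_FP true) (fanoutFn_mem_FP (paramsF_mem_FP j i) (comp_mem_FP ForrMem.revItemsF_mem_FP (sndPow_mem_FP 2)))
  · exact prepF_mem_FP _ _ (numF_mem_FP _ _) (ΘJ_mem_FP j 8)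
  · exact templF_mem_FP _ (ΘJ_mem_FP j)

/-- `blockF j ∈ FP`. [cite: AroraBarak2009, §1.3] -/
theorem blockF_mem_FP (j : ℕ) : blockF j ∈ FP := concatF_mem_FP (partsF_mem_FP j)

/-- **The instance code**: `⟨1^{24(4w+7)}, the 24 block codes⟩`. [cite: AaronsonAmbainis2018, §6 Lemma 24 (p. 26)] -/
def outF : List Bool → List Bool :=
  fanoutFn (polyFn (C 24 * (C 4 * X + C 7)) ∘ uwF) (concatF ((List.range 24).map blockF))

/-- **`outF ∈ FP`.** [cite: AroraBarak2009, §1.3] -/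
theorem outF_mem_FP : outF ∈ FP :=
  fanoutFn_mem_FP (comp_mem_FP (polyFn_mem_FP _) uwF_mem_FP) (concatF_mem_FP fun f hf => by
    simp only [List.mem_map] at hf
    obtain ⟨j, -, rfl⟩ := hf
    exact blockF_mem_FP j)

/-! ### The value on the record of the reduction -/

section value

variable {n m : ℕ} {x : List Bool} {cs : List NGate}

/-- The record of the reduction: `⟨x, ⟨bin n, ⟨1^m, encList (codes of cs)⟩⟩⟩`. [folklore] -/
def inRec (x : List Bool) (m : ℕ) (cs : List NGate) : List Bool :=
  boolPair x (boolPair (encodeNat x.length) (boolPair (unaryEncodeNat m) (encList (cs.map NGate.code))))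

/-- `w` is read off the record. [folklore] -/
theorem length_uwF_inRec (x : List Bool) (m : ℕ) (cs : List NGate) : (uwF (inRec x m cs)).length = x.length + m :=
  length_uwF_record x _ m _

/-- The templates on the record. [folklore] -/
theorem templF_inRec (T : List NGate) (j : ℕ) (x : List Bool) (m : ℕ) (cs : List NGate) :
    templF T (ΘJ j) (inRec x m cs) = encList ((T.map (NGate.ren (θJ (x.length + m) j))).map NGate.code) :=
  templF_apply fun i => by rw [ΘJ_apply, length_uwF_inRec]

/-- The OR parts on the record. [folklore] -/
theorem orF_inRec (j : ℕ) (x : List Bool) (m : ℕ) (cs : List NGate) (rev : Bool) :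
    iteFn (isNilFn ∘ uwF) (fun _ => []) (templF (bif rev then orTm.reverse else orTm) (ΘJ j)) (inRec x m cs) =
      encList ((bif rev then (orPart x.length m j).reverse else orPart x.length m j).map NGate.code) := by
  have hnil : (isNilFn ∘ uwF) (inRec x m cs) = [decide (x.length + m = 0)] := by
    simp only [Function.comp_apply, isNilFn, ← List.length_eq_zero_iff, length_uwF_inRec]
  by_cases hw : x.length + m = 0
  · rw [iteFn_apply_true (by rw [hnil, hw]; rfl), orPart, if_neg (by omega)]
    cases rev <;> rfl
  · rw [iteFn_apply_false (by rw [hnil, decide_eq_false hw]), templF_inRec, orPart, if_pos (by omega)]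
    refine congrArg (fun l => encList (List.map NGate.code l)) ?_
    have key : orTm.map (NGate.ren (θJ (x.length + m) j)) =
        (orN.orN' (j * (Kw (x.length + m) + 2 + 1)) (x.length + m + j * (Kw (x.length + m) + 2 + 1))
          (2 * (x.length + m) + j * (Kw (x.length + m) + 2 + 1)) (3 * (x.length + m) + j * (Kw (x.length + m) + 2 + 1))
          (4 * (x.length + m) + j * (Kw (x.length + m) + 2 + 1)) (4 * (x.length + m) + 1 + j * (Kw (x.length + m) + 2 + 1))
          (4 * (x.length + m) + 2 + j * (Kw (x.length + m) + 2 + 1))).flatMap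
          (realGatesN' (catJ x.length m j) (rhoJ x.length m j)) := by
      rw [orTm, List.map_flatMap]
      have h1 : ∀ g, (realGatesN' 7 8 g).map (NGate.ren (θJ (x.length + m) j)) =
          realGatesN' (catJ x.length m j) (rhoJ x.length m j) (g.ren (θJ (x.length + m) j)) := fun g => by
        rw [ren_realGatesN', θJ_7, θJ_8]
      simp only [h1]
      rw [show orN.orN' (j * (Kw (x.length + m) + 2 + 1)) (x.length + m + j * (Kw (x.length + m) + 2 + 1))
          (2 * (x.length + m) + j * (Kw (x.length + m) + 2 + 1)) (3 * (x.length + m) + j * (Kw (x.length + m) + 2 + 1))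
          (4 * (x.length + m) + j * (Kw (x.length + m) + 2 + 1)) (4 * (x.length + m) + 1 + j * (Kw (x.length + m) + 2 + 1))
          (4 * (x.length + m) + 2 + j * (Kw (x.length + m) + 2 + 1)) =
          (orN.orN' 0 1 2 3 4 5 6).map (NGate.ren (θJ (x.length + m) j)) by
        rw [ren_orN', θJ_0, θJ_1, θJ_2, θJ_3, θJ_4, θJ_5, θJ_6], flatMap_map_comp]
      rfl
    cases rev
    · exact key
    · simp only [cond_true, List.map_reverse, key]

/-- The gadget parts on the record. [folklore] -/
theorem gadF_inRec (j : ℕ) (x : List Bool) (m : ℕ) (cs : List NGate) (rev : Bool) :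
    templF (bif rev then gadTm.reverse else gadTm) (ΘJ j) (inRec x m cs) =
      encList ((bif rev then (gadgetN' (catJ x.length m j) (rhoJ x.length m j) (hlpJ x.length m j)).reverse
        else gadgetN' (catJ x.length m j) (rhoJ x.length m j) (hlpJ x.length m j)).map NGate.code) := by
  rw [templF_inRec]
  refine congrArg (fun l => encList (List.map NGate.code l)) ?_
  have key : gadTm.map (NGate.ren (θJ (x.length + m) j)) = gadgetN' (catJ x.length m j) (rhoJ x.length m j) (hlpJ x.length m j) := by
    rw [gadTm, ren_gadgetN', θJ_7, θJ_8, θJ_9]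
  cases rev
  · exact key
  · simp only [cond_true, List.map_reverse, key]

/-- The copy part on the record. [folklore] -/
theorem copyF_inRec (j : ℕ) (x : List Bool) (m : ℕ) (cs : List NGate) :
    templF copyTm (ΘJ j) (inRec x m cs) =
      encList ((copyN (4 * (x.length + m) + 2 + j * (Kw (x.length + m) + 2 + 1)) (4 * (x.length + m) + 3 + j * (Kw (x.length + m) + 2 + 1))).map
        NGate.code) := by
  rw [templF_inRec, copyTm, ren_copyN, θJ_6, θJ_10]

/-- The parameter record on the record. [folklore] -/
theorem paramsF_inRec (j i : ℕ) (x : List Bool) (m : ℕ) (cs : List NGate) :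
    paramsF j i (inRec x m cs) = paramRec (baseJ x.length m j i) (catJ x.length m j) (rhoJ x.length m j) := by
  simp only [paramsF, fanoutFn_apply, βJ, numF_apply, ΘJ_apply, length_uwF_inRec, paramRec, θJ_7, θJ_8, baseJ_eq]

/-- The transcription parts on the record. [folklore] -/
theorem transF_inRec (j i : ℕ) (x : List Bool) (m : ℕ) {cs : List NGate} (hcs : ∀ g ∈ cs, WfC g) :
    (transF false ∘ fanoutFn (paramsF j i) (sndPow 2)) (inRec x m cs) = encList ((transPart x.length m cs j i).map NGate.code)
    ∧ (transF true ∘ fanoutFn (paramsF j i) (ForrMem.revItemsF ∘ sndPow 2)) (inRec x m cs) =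
        encList ((transPartR x.length m cs j i).map NGate.code) := by
  have hL : sndPow 2 (inRec x m cs) = encList (cs.map NGate.code) := by simp [inRec, sndPow]
  constructor
  · simp only [Function.comp_apply, fanoutFn_apply, hL, paramsF_inRec]
    rw [transF_apply false _ _ _ hcs]; rfl
  · simp only [Function.comp_apply, fanoutFn_apply, hL, paramsF_inRec, ForrMem.revItemsF_apply, decNil_encList, ← List.map_reverse]
    rw [transF_apply true _ _ _ (fun g hg => hcs g (List.mem_reverse.1 hg))]; rfl

/-- The preparation parts on the record. [folklore] -/
theorem prepF_inRec {j : ℕ} (hj : j < 24) {i : ℕ} (hi : i < 4) (x : List Bool) (m : ℕ) (cs : List NGate) (rev : Bool) :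
    prepF Qprep rev (βJ j i) (ΘJ j 8) (inRec x m cs) =
      encList ((bif rev then prepPartR x.length m x j i else prepPart x.length m x j i).map NGate.code) := by
  have hx : fstF (inRec x m cs) = x := by simp [inRec]
  have hβ : βJ j i (inRec x m cs) = encodeNat (baseJ x.length m j i) := by
    simp only [βJ, numF_apply, length_uwF_inRec, baseJ_eq]
  have hρ : ΘJ j 8 (inRec x m cs) = encodeNat (rhoJ x.length m j) := by
    rw [ΘJ_apply, length_uwF_inRec, θJ_8]
  have hQ : ∀ t, t < (fstF (inRec x m cs)).length →
      (prepPieceF rev (βJ j i) (ΘJ j 8) (boolPair (inRec x m cs) (ones t))).length ≤ Qprep.eval (inRec x m cs).length := by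
    intro t ht
    refine (length_prepPieceF_le rev (a := 99) (c := 167) (fun r => ?_) (fun r => length_ΘJ_le hj 8 r) _ ht).trans ?_
    · refine (length_numF_le _ _ r).trans ?_; nlinarith
    · simp [Qprep]; nlinarith
  rw [prepF_apply rev (catJ x.length m j) hβ hρ hQ, hx]
  cases rev <;> rfl

/-- **The value of a block on the record.** [cite: AaronsonAmbainis2018, §6 Lemma 24 (p. 26)] -/
theorem blockF_inRec {j : ℕ} (hj : j < 24) (x : List Bool) (m : ℕ) {cs : List NGate} (hcs : ∀ g ∈ cs, WfC g) :
    blockF j (inRec x m cs) =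
      encList (((blockNL x.length m x cs).map (NGate.shift (j * (Kw (x.length + m) + 2 + 1)))).map NGate.code) := by
  have hr4 : List.range 4 = [0, 1, 2, 3] := rfl
  have hg0 := gadF_inRec j x m cs false
  have hg1 := gadF_inRec j x m cs true
  have ho0 := orF_inRec j x m cs false
  have ho1 := orF_inRec j x m cs true
  simp only [cond_false, cond_true] at hg0 hg1 ho0 ho1
  have hp := fun (i : ℕ) (hi : i < 4) (rev : Bool) => prepF_inRec hj hi x m cs rev
  have ht := fun i => (transF_inRec j i x m hcs).1
  have htr := fun i => (transF_inRec j i x m hcs).2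
  simp only [Function.comp_apply] at ht htr
  -- the left-hand side, part by part
  rw [blockF, concatF, partsF]
  simp only [hr4, List.reverse_cons, List.reverse_nil, List.nil_append, List.map_cons, List.map_nil, List.cons_append,
    List.flatMap_cons, List.flatMap_nil, List.append_nil, Function.comp_apply]
  rw [hg0, hg1, ho0, ho1, copyF_inRec, ht 0, ht 1, ht 2, ht 3, htr 0, htr 1, htr 2, htr 3,
    hp 0 (by norm_num) false, hp 1 (by norm_num) false, hp 2 (by norm_num) false, hp 3 (by norm_num) false,
    hp 0 (by norm_num) true, hp 1 (by norm_num) true, hp 2 (by norm_num) true, hp 3 (by norm_num) true]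
  simp only [cond_false, cond_true]
  -- the right-hand side, part by part
  rw [blockNL_shift]
  simp only [List.map_append, encList_append', List.map_reverse, hr4, List.reverse_cons, List.reverse_nil,
    List.nil_append, List.cons_append, List.flatMap_cons, List.flatMap_nil, List.append_nil, List.append_assoc]

/-- **The value of `outF` on the record of the reduction**: the code of the QSIM instance
`⟨1^{24(4w+7)}, encList (codes of instNL)⟩`. [cite: AaronsonAmbainis2018, §6 Lemma 24 (p. 26)] -/
theorem outF_inRec (x : List Bool) (m : ℕ) {cs : List NGate} (hcs : ∀ g ∈ cs, WfC g) :
    outF (inRec x m cs) =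
      boolPair (unaryEncodeNat (24 * (Kw (x.length + m) + 2 + 1))) (encList ((instNL x.length m x cs).map NGate.code)) := by
  have h1 : (polyFn (C 24 * (C 4 * X + C 7)) ∘ uwF) (inRec x m cs) = unaryEncodeNat (24 * (Kw (x.length + m) + 2 + 1)) := by
    simp only [Function.comp_apply, polyFn_apply, length_uwF_inRec, unaryEncodeNat_eq_ones, Kw, eval_mul, eval_add, eval_C, eval_X]
  have h2 : concatF ((List.range 24).map blockF) (inRec x m cs) = encList ((instNL x.length m x cs).map NGate.code) := by
    rw [instNL, encList_map_flatMap, concatF, flatMap_map_comp]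
    refine flatMap_congr_mem fun j hj => ?_
    rw [List.mem_range] at hj
    rw [Function.comp_apply, blockF_inRec hj x m hcs]
  rw [outF, fanoutFn_apply, h1, h2]

end value

end Lemma24

end Literature.Computability.QuantumComplexity

end
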